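import Summits.AnomalousDissipation.AnomalousDissipation.Theorems.BaireTransferRobustLoudUpgradeLineLeaf
import Summits.AnomalousDissipation.AnomalousDissipation.Theorems.BaireTransferRobustLoudUpgradeStubSteadyWindow
import Summits.AnomalousDissipation.AnomalousDissipation.Theorems.BaireTransferRobustLoudUpgradeStubSteadyPersist
import Summits.AnomalousDissipation.AnomalousDissipation.Theorems.BaireTransferRobustLoudUpgradeStubPeriodicWindow
import Summits.AnomalousDissipation.AnomalousDissipation.Theorems.BaireTransferRobustLoudUpgradeStubPeriodicIsSteady

/-!
# Line `malkin-cone-group-orbits`, COMPANION skeleton (lead c1) for the crux `BaireTransfer.RobustLoudUpgrade`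
# (stmt-AnomalousDissipation-1144): the laminar corner of the residual for PERIODIC witnesses of ANY mean

Companion of the generation-1 skeleton v5 (`Lines/malkin_cone_group_orbits.lean`, lead `…-1144-1`: stubs
`stub_borderedFamily`, `stub_familyBand`, residual `stub_tameDenseSimple`).  This file does NOT reshape that
skeleton and registers its stubs ADDITIVELY (`workitem stub-add`).  Scope: the residual
`loud ⊆ closure (tameLeaf ∪ simpleSteady)(2E, ε/2)` quantifies over loud forces whose witness is a genuinely
TIME-PERIODIC classical solution of ARBITRARY MEAN at some `ν ∈ (0,a)`; the one regime in which such a witness is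
controlled today is the laminar corner `‖f_c‖₂ ≤ κ ν²` (leaf-uniqueness Grashof number): there the witness IS the
unique classical steady state of its conserved-mean leaf, and that state is leaf-nondegenerate, so
`c ∈ nondegSteadyLeaf(E', ε') ⊆ tameLeaf(E', ε')` for every `E'` above / `ε'` below its own budgets — in particular at
`(2E, ε/2)`.  (So far the tree had this only for MEAN-ZERO STEADY witnesses: `SmallData.smallData_mem_censusSteady`.)

Three Pi-form stubs (workers) + the assembly (lead c1):
* `stub_leafSteadySmallExists` — small-data classical steady state of PRESCRIBED mean `m` on the Fourier lattice
  (contraction in the drifted lattice space of `SteadyNSLatticePersistenceDrift`, `BilinearFixedPoint`), with the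
  `H²`/`H¹` smallness it is born with;
* `stub_smallFlowNondeg` — a smooth divergence-free field with `‖Δv‖₂ ≤ κν` has NO mean-zero classical kernel of its
  Navier–Stokes linearisation (lattice coercivity: `SteadyLattice.tsum_enorm_sq_leray_nl_cf_le` +
  `KolmogorovShear.fourier_eq_of_linearizedNSOperator_eq_zero`);
* `stub_periodicIsSteady` — a time-periodic classical solution sharing force, viscosity and spatial mean with a classical
  steady state of small enstrophy `‖∇v‖₂ ≤ κν` coincides with it (decaying twin of `TorusClassicalNSUniqueness`:
  `d/dt ∫‖w‖² ≤ −2(ν − C‖∇v‖₂)‖∇w‖₂² ≤ −4π²ν ∫‖w‖²`, periodicity);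
* assembly `laminarPeriodic_mem_nondegSteadyLeaf` and the residual's laminar complement `loud_laminar_subset_tameLeaf`.
-/

set_option linter.dupNamespace false

noncomputable section

open scoped BigOperators Topology
open Filter Set Function TopologicalSpace MeasureTheory

namespace Summit.AnomalousDissipation.AnomalousDissipation.Cruxes.RobustLoudUpgrade.LaminarCorner

open Literature.Analysis.FunctionSpaces Literature.Analysis.FunctionSpaces.Torus
open Literature.Analysis.FluidPDE
open Summit.AnomalousDissipation.AnomalousDissipation.Theses.BaireTransfer
open Summit.AnomalousDissipation.AnomalousDissipation.Theorems.RobustLoudUpgrade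

/-! ## §1 The three registered stubs (Pi-form, no new vocabulary) -/

/-- **stub_leafSteadySmallExists** (lattice; OPEN — wave 1).  SMALL-DATA STEADY STATES OF PRESCRIBED MEAN: there is
`κ > 0` such that for every finite family `S`, every `c ∈ P_S`, every `ν > 0` with `‖f_c‖₂ ≤ κ ν²` and EVERY mean
`m ∈ ℝ³`, the steady Navier–Stokes system `NS_ν(f_c)` on `T³` has a classical steady state `v` of mean `m`
(`∫ v = m`) with `‖Δv‖₂² ≤ 4‖f_c‖₂²/ν²` and `‖∇v‖₂² ≤ ‖f_c‖₂²/ν²` (contraction for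
`4π²ν x + D_m x + B(x,x) = F_c` in the lattice space `W` of `SteadyNSLatticePersistence(Drift)`: the drifted Stokes
multiplier `4π²ν + 2πi(k·m)/|k|²` is bounded below by `4π²ν` uniformly in `m`; `BilinearFixedPoint`; synthesis
`steadyState_of_fourier_drift`; Parseval).  (Temam 1979 Ch. II §1 Thm 1.3, in every conserved-mean leaf.) [folklore] -/
theorem stub_leafSteadySmallExists :
    ∃ κ : ℝ, 0 < κ ∧ ∀ (S : Finset (Fin 3 → ℤ)) (c : Coeff S) (ν : ℝ) (m : EuclideanSpace ℝ (Fin 3)),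
      0 < ν → Real.sqrt (∫ x, ‖force S c x‖ ^ 2) ≤ κ * ν ^ 2 →
      ∃ (v : UnitAddTorus (Fin 3) → EuclideanSpace ℝ (Fin 3)) (q : UnitAddTorus (Fin 3) → ℝ),
        Torus.IsSteadyNSState ν (force S c) v q ∧ (∫ x, v x) = m ∧
        (∫ x, ‖laplacian v x‖ ^ 2) ≤ 4 * (∫ x, ‖force S c x‖ ^ 2) / ν ^ 2 ∧
        gradNormSq v ≤ (∫ x, ‖force S c x‖ ^ 2) / ν ^ 2 := by
  sorry

/-- **stub_smallFlowNondeg** (lattice coercivity; OPEN — wave 1).  SMALL SMOOTH FLOWS ARE LINEARLY NONDEGENERATE: there is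
`κ > 0` such that every smooth divergence-free field `v` on `T³` (any mean) with `‖Δv‖₂ ≤ κ ν` has no mean-zero classical
kernel of `L(ν,v) w = νΔw − (v·∇)w − (w·∇)v − ∇q` (`¬ Torus.IsLinNSEigenvalue ν v 0`): Fourier-transform the kernel
equation (`KolmogorovShear.fourier_eq_of_linearizedNSOperator_eq_zero`), Leray-project, split off the drift of the mean
(modulus `≥ 4π²ν|k|²`), and bound the remaining convective symbols by `SteadyLattice.tsum_enorm_sq_leray_nl_cf_le`
(`(36π)² Z ‖Δv‖²‖·‖²`-type, `Z = ∑|k|⁻⁴`). [folklore] -/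
theorem stub_smallFlowNondeg :
    ∃ κ : ℝ, 0 < κ ∧ ∀ (ν : ℝ) (v : UnitAddTorus (Fin 3) → EuclideanSpace ℝ (Fin 3)),
      0 < ν → IsSmooth v → IsDivFree v → Real.sqrt (∫ x, ‖laplacian v x‖ ^ 2) ≤ κ * ν →
      ¬ Torus.IsLinNSEigenvalue ν v 0 := by
  sorry

-- `stub_periodicIsSteady` LANDED (wave 1, p98044): `Theorems/BaireTransferRobustLoudUpgradeStubPeriodicIsSteady.lean`,
-- `Summit.AnomalousDissipation.AnomalousDissipation.Theorems.RobustLoudUpgrade.LaminarCorner.stub_periodicIsSteady` (imported).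

/-! ## §2 Assembly (lead c1): laminar periodic witnesses of any mean ARE leaf-nondegenerate steady states -/

/-- The squared gradient norm of the zero field vanishes. [folklore] -/
theorem gradNormSq_zero : gradNormSq (0 : UnitAddTorus (Fin 3) → EuclideanSpace ℝ (Fin 3)) = 0 := by
  simp [gradNormSq, Torus.partialDeriv, Torus.lineDeriv]

/-- **Spatial means of a classical Navier–Stokes solution on `ℝ × T³` with a mean-zero force are conserved**:
`d/dt ∫ u(t) = ∫ (νΔu − (u·∇)u − ∇p + f) = 0` (each integral vanishes on the torus). [folklore] -/
theorem integral_velocity_eq {ν : ℝ} {f : UnitAddTorus (Fin 3) → EuclideanSpace ℝ (Fin 3)}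
    {u : ℝ → UnitAddTorus (Fin 3) → EuclideanSpace ℝ (Fin 3)} {p : ℝ → UnitAddTorus (Fin 3) → ℝ}
    (h : IsClassicalNSSolutionOn Set.univ ν (fun _ => f) u p) (hf : HasZeroMean f) (t : ℝ) :
    (∫ x, u t x) = ∫ x, u 0 x := by
  -- the mean has derivative `∫ ∂ₜu = 0` at every time
  have hderiv : ∀ s : ℝ, HasDerivAt (fun r => ∫ x, u r x) 0 s := by
    intro s
    have hs : s ∈ (Set.univ : Set ℝ) := Set.mem_univ s
    have hd := h.smooth_velocity.hasDerivWithinAt_integral convex_univ hs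
    rw [hasDerivWithinAt_univ] at hd
    have hus : IsSmooth (u s) := h.smooth_velocity.isSmooth_slice hs
    have hps : IsSmooth (p s) := h.smooth_pressure.isSmooth_slice hs
    have hsmf : IsSmooth f := by
      -- the force is the residual of the momentum equation at `t = s`: `f = ∂ₜu + (u·∇)u − νΔu + ∇p`, a sum of smooth slices
      have hmom := h.momentum s hs
      have e : f = fun x => Torus.timeDerivWithin Set.univ u s x + convect (u s) (u s) x - ν • laplacian (u s) x +
          Torus.gradient (p s) x := by
        funext x
        have h1 := hmom x
        rw [h1]
        abel
      rw [e]
      exact (((h.smooth_velocity.isSmooth_timeDerivWithin uniqueDiffOn_univ hs).add (hus.convect hus)).sub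
        (hus.laplacian.smul ν)).add hps.gradient
    have hval : (∫ x, Torus.timeDerivWithin Set.univ u s x) = 0 := by
      have e : (fun x => Torus.timeDerivWithin Set.univ u s x) =
          fun x => ν • laplacian (u s) x - Torus.gradient (p s) x + f x - convect (u s) (u s) x := by
        funext x
        have h1 := h.momentum s hs x
        rw [eq_sub_of_add_eq h1]
      rw [e, integral_sub, integral_add, integral_sub, integral_smul, integral_laplacian_eq_zero_of_isSmooth hus,
        integral_gradient_eq_zero hps, integral_convect_self_eq_zero hus (h.divFree s hs)]
      · rw [show (∫ x, f x) = 0 from hf]; simp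
      · exact (hus.laplacian.smul ν).integrable
      · exact hps.gradient.integrable
      · exact ((hus.laplacian.smul ν).sub hps.gradient).integrable
      · exact hsmf.integrable
      · exact (((hus.laplacian.smul ν).sub hps.gradient).add hsmf).integrable
      · exact (hus.convect hus).integrable
    rwa [hval] at hd
  have hdiff : Differentiable ℝ fun r => ∫ x, u r x := fun s => (hderiv s).differentiableAt
  exact is_const_of_deriv_eq_zero hdiff (fun s => (hderiv s).deriv) t 0

/-- **Laminar periodic witnesses are steady and leaf-nondegenerate** (assembly of the three stubs): there is `κ > 0`
such that every `τ`-periodic classical solution `u` of `NS_ν(f_c)` on `ℝ × T³`, `ν > 0`, of ANY mean, with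
`‖f_c‖₂ ≤ κ ν²`, is constant in time, equal to a classical steady state `v` of `NS_ν(f_c)` whose linearisation has
no mean-zero classical kernel. [folklore] -/
theorem laminarPeriodic_steady :
    ∃ κ : ℝ, 0 < κ ∧ ∀ (S : Finset (Fin 3 → ℤ)) (c : Coeff S) (ν τ : ℝ)
      (u : ℝ → UnitAddTorus (Fin 3) → EuclideanSpace ℝ (Fin 3)) (p : ℝ → UnitAddTorus (Fin 3) → ℝ),
      0 < ν → 0 < τ → IsClassicalNSSolutionOn Set.univ ν (fun _ => force S c) u p → Function.Periodic u τ →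
      Real.sqrt (∫ x, ‖force S c x‖ ^ 2) ≤ κ * ν ^ 2 →
      ∃ (v : UnitAddTorus (Fin 3) → EuclideanSpace ℝ (Fin 3)) (q : UnitAddTorus (Fin 3) → ℝ),
        Torus.IsSteadyNSState ν (force S c) v q ∧ ¬ Torus.IsLinNSEigenvalue ν v 0 ∧ ∀ t, u t = v := by
  obtain ⟨κ₁, hκ₁, h₁⟩ := stub_leafSteadySmallExists
  obtain ⟨κ₂, hκ₂, h₂⟩ := stub_smallFlowNondeg
  obtain ⟨κ₃, hκ₃, h₃⟩ := Summit.AnomalousDissipation.AnomalousDissipation.Theorems.RobustLoudUpgrade.LaminarCorner.stub_periodicIsSteady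
  refine ⟨min κ₁ (min (κ₂ / 2) κ₃), lt_min hκ₁ (lt_min (half_pos hκ₂) hκ₃), ?_⟩
  intro S c ν τ u p hν hτ hsol hper hsmall
  set F : ℝ := Real.sqrt (∫ x, ‖force S c x‖ ^ 2) with hF
  have hFsq : F ^ 2 = ∫ x, ‖force S c x‖ ^ 2 := Real.sq_sqrt (integral_nonneg fun _ => sq_nonneg _)
  have hk₁ : F ≤ κ₁ * ν ^ 2 := hsmall.trans (mul_le_mul_of_nonneg_right (min_le_left _ _) (sq_nonneg ν))
  have hk₂ : F ≤ κ₂ / 2 * ν ^ 2 :=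
    hsmall.trans (mul_le_mul_of_nonneg_right ((min_le_right _ _).trans (min_le_left _ _)) (sq_nonneg ν))
  have hk₃ : F ≤ κ₃ * ν ^ 2 :=
    hsmall.trans (mul_le_mul_of_nonneg_right ((min_le_right _ _).trans (min_le_right _ _)) (sq_nonneg ν))
  -- the small steady state in the witness's leaf
  obtain ⟨v, q, hst, hmean, hlap, hgrad⟩ := h₁ S c ν (∫ x, u 0 x) hν hk₁
  have hvs : IsSmooth v := hst.smooth_velocity.isSmooth_slice (Set.mem_univ (0 : ℝ))
  have hvd : IsDivFree v := hst.divFree 0 (Set.mem_univ (0 : ℝ))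
  -- it is leaf-nondegenerate
  have hnd : ¬ Torus.IsLinNSEigenvalue ν v 0 := by
    refine h₂ ν v hν hvs hvd ?_
    have h1 : Real.sqrt (∫ x, ‖laplacian v x‖ ^ 2) ≤ 2 * F / ν := by
      rw [Real.sqrt_le_left (by positivity)]
      rw [div_pow, mul_pow, hFsq]
      have : (2 : ℝ) ^ 2 * (∫ x, ‖force S c x‖ ^ 2) / ν ^ 2 = 4 * (∫ x, ‖force S c x‖ ^ 2) / ν ^ 2 := by norm_num
      rw [this]; exact hlap
    calc Real.sqrt (∫ x, ‖laplacian v x‖ ^ 2) ≤ 2 * F / ν := h1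
      _ ≤ 2 * (κ₂ / 2 * ν ^ 2) / ν := by gcongr
      _ = κ₂ * ν := by field_simp
  -- the witness has the conserved mean of `v`, hence IS `v`
  have hmeans : ∀ t, (∫ x, u t x) = ∫ x, v x := fun t => by
    rw [hmean]; exact integral_velocity_eq hsol (SteadyPersist.hasZeroMean_force' c) t
  have huv : ∀ t, u t = v := by
    refine h₃ ν τ (force S c) u p v q hν hτ hsol hper hst hmeans ?_
    have h1 : Real.sqrt (gradNormSq v) ≤ F / ν := by
      rw [Real.sqrt_le_left (by positivity), div_pow, hFsq]
      exact hgrad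
    calc Real.sqrt (gradNormSq v) ≤ F / ν := h1
      _ ≤ κ₃ * ν ^ 2 / ν := by gcongr
      _ = κ₃ * ν := by field_simp
  exact ⟨v, q, hst, hnd, huv⟩

/-- **The laminar complement of the residual**: a loud force with a laminar witness is tame itself — it lies in
`nondegSteadyLeaf ⊆ tameLeaf` at the relaxed budgets `(2E, ε/2)` (indeed at every `E' > ⟨‖u‖²⟩`, `ε' < ⟨ν‖∇u‖²⟩`).
[folklore] -/
theorem loud_laminar_subset_tameLeaf :
    ∃ κ : ℝ, 0 < κ ∧ ∀ (S : Finset (Fin 3 → ℤ)) (a E ε : ℝ) (c : Coeff S) (ν τ : ℝ)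
      (u : ℝ → UnitAddTorus (Fin 3) → EuclideanSpace ℝ (Fin 3)) (p : ℝ → UnitAddTorus (Fin 3) → ℝ),
      0 < ε → 0 < ν → ν < a → 0 < τ → IsClassicalNSSolutionOn Set.univ ν (fun _ => force S c) u p →
      Function.Periodic u τ → meanEnergy u ≤ E → ε ≤ meanDissipation ν u →
      Real.sqrt (∫ x, ‖force S c x‖ ^ 2) ≤ κ * ν ^ 2 → c ∈ tameLeaf S a (2 * E) (ε / 2) := by
  obtain ⟨κ, hκ, h⟩ := laminarPeriodic_steady
  refine ⟨κ, hκ, fun S a E ε c ν τ u p hε hν hνa hτ hsol hper hE hε' hsmall => ?_⟩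
  obtain ⟨v, q, hst, hnd, huv⟩ := h S c ν τ u p hν hτ hsol hper hsmall
  have hvs : IsSmooth v := hst.smooth_velocity.isSmooth_slice (Set.mem_univ (0 : ℝ))
  have hu : u = fun _ => v := funext huv
  rw [hu, SteadyWindow.meanEnergy_const] at hE
  rw [hu, SteadyWindow.meanDissipation_const ν hvs] at hε'
  -- positive dissipation forces `v ≠ 0`, hence positive energy, hence `0 < E`
  have hE0 : 0 < E := by
    have hG : 0 < gradNormSq v := by
      by_contra hG
      have : ν * gradNormSq v ≤ 0 := mul_nonpos_of_nonneg_of_nonpos hν.le (le_of_not_gt hG)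
      linarith
    have hv0 : v ≠ 0 := by
      rintro rfl
      rw [gradNormSq_zero] at hG
      exact lt_irrefl _ hG
    have hint : 0 < ∫ x, ‖v x‖ ^ 2 := by
      by_contra hle
      exact hv0 (eq_zero_of_integral_norm_sq_nonpos hvs (le_of_not_gt hle))
    linarith
  refine Or.inl (Or.inl (Or.inl (Or.inl (Or.inl ⟨ν, hν, hνa, v, q, hst, ?_, ?_, hnd⟩))))
  · rw [SteadyWindow.meanEnergy_const]; linarith
  · rw [SteadyWindow.meanDissipation_const ν hvs]; linarith

/-! ## §3 How the companion plugs into ANY residual of the line (sorry-free composition)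

With `κlam` the constant of `loud_laminar_subset_tameLeaf`, every loud force either is tame itself (laminar witness) or
has a witness ABOVE the laminar corner (`loudTurb`).  Hence for every tame union `T ⊇ tameLeaf` whose classes upgrade to
`closure (interior LOUD)` (e.g. the generation-1 lead's `tameLeaf ∪ simpleSteady`), the residual may be RESTRICTED to
`loudTurb` — witnesses at Grashof number above the leaf-uniqueness threshold — and still closes the crux by name. -/

/-- The laminar constant of the companion skeleton (the `κ` of `loud_laminar_subset_tameLeaf`). [folklore] -/
def κlam : ℝ := Classical.choose loud_laminar_subset_tameLeaf

theorem κlam_spec : 0 < κlam ∧ ∀ (S : Finset (Fin 3 → ℤ)) (a E ε : ℝ) (c : Coeff S) (ν τ : ℝ)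
      (u : ℝ → UnitAddTorus (Fin 3) → EuclideanSpace ℝ (Fin 3)) (p : ℝ → UnitAddTorus (Fin 3) → ℝ),
      0 < ε → 0 < ν → ν < a → 0 < τ → IsClassicalNSSolutionOn Set.univ ν (fun _ => force S c) u p →
      Function.Periodic u τ → meanEnergy u ≤ E → ε ≤ meanDissipation ν u →
      Real.sqrt (∫ x, ‖force S c x‖ ^ 2) ≤ κlam * ν ^ 2 → c ∈ tameLeaf S a (2 * E) (ε / 2) :=
  Classical.choose_spec loud_laminar_subset_tameLeaf

/-- **Loud forces with a witness ABOVE the laminar corner** `‖f_c‖₂ > κlam ν²` (the only ones the residual still has to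
treat). [folklore] -/
def loudTurb (S : Finset (Fin 3 → ℤ)) (a E ε : ℝ) : Set (Coeff S) :=
  {c | ∃ ν : ℝ, 0 < ν ∧ ν < a ∧ ∃ (τ : ℝ) (u : ℝ → UnitAddTorus (Fin 3) → EuclideanSpace ℝ (Fin 3))
      (p : ℝ → UnitAddTorus (Fin 3) → ℝ), 0 < τ ∧
    IsClassicalNSSolutionOn Set.univ ν (fun _ => force S c) u p ∧ Function.Periodic u τ ∧
      meanEnergy u ≤ E ∧ ε ≤ meanDissipation ν u ∧ κlam * ν ^ 2 < Real.sqrt (∫ x, ‖force S c x‖ ^ 2)}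

/-- **Dichotomy**: a loud force is tame at the relaxed budgets (laminar witness) or turbulent-loud. [folklore] -/
theorem loud_subset_tameLeaf_union_loudTurb (S : Finset (Fin 3 → ℤ)) {a E ε : ℝ} (hε : 0 < ε) :
    loud S a E ε ⊆ tameLeaf S a (2 * E) (ε / 2) ∪ loudTurb S a E ε := by
  intro c hc
  obtain ⟨ν, hν, hνa, τ, u, p, hτ, hsol, hper, hE, hε'⟩ := hc
  by_cases hlam : Real.sqrt (∫ x, ‖force S c x‖ ^ 2) ≤ κlam * ν ^ 2
  · exact Or.inl (κlam_spec.2 S a E ε c ν τ u p hε hν hνa hτ hsol hper hE hε' hlam)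
  · exact Or.inr ⟨ν, hν, hνa, τ, u, p, hτ, hsol, hper, hE, hε', lt_of_not_ge hlam⟩

/-- **Composition with a residual restricted to turbulent witnesses**: for any tame union `T ⊇ tameLeaf` that upgrades
to `closure (interior LOUD)`, the restricted residual `loudTurb ⊆ closure T(2E, ε/2)` proves the crux BY NAME
(`S₀ := unitStock`). [folklore] -/
theorem RobustLoudUpgrade_of_turbulentResidual (T : ∀ S : Finset (Fin 3 → ℤ), ℝ → ℝ → ℝ → Set (Coeff S))
    (hTame : ∀ (S : Finset (Fin 3 → ℤ)) (a E ε : ℝ), tameLeaf S a E ε ⊆ T S a E ε)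
    (hT : ∀ (S : Finset (Fin 3 → ℤ)) (a E ε : ℝ), T S a E ε ⊆ closure (interior (loud S a E ε)))
    (hRes : ∀ S : Finset (Fin 3 → ℤ), unitStock ⊆ S → ∀ (a E ε : ℝ), 0 < a → 0 < ε →
      loudTurb S a E ε ⊆ closure (T S a (2 * E) (ε / 2))) :
    RobustLoudUpgrade := by
  refine ⟨unitStock, fun S hS E ε hε j => ?_⟩
  have ha : (0 : ℝ) < 1 / ((j : ℝ) + 1) := by positivity
  intro c hc
  have hsub : T S (1 / ((j : ℝ) + 1)) (2 * E) (ε / 2) ⊆ closure (interior (loud S (1 / ((j : ℝ) + 1)) (2 * E) (ε / 2))) :=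
    hT S _ _ _
  rcases loud_subset_tameLeaf_union_loudTurb S hε hc with h | h
  · exact hsub (hTame S _ _ _ h)
  · exact closure_minimal hsub isClosed_closure (hRes S hS _ E ε ha hε h)

/-! ## §4 Cycle-2 preview (lead c1): the periodic SADDLE-NODE — `simplePeriodic`, the periodic twin of `simpleSteady`

At a loud periodic orbit whose Floquet multiplier `1` is geometrically simple but algebraically DOUBLE (saddle-node of
cycles: `∂ₜu` has a periodic Jordan partner) with ONE first-order-visible force direction `d`, the doubly bordered implicit
function theorem (`Literature.Analysis.Calculus.saddleNode_bordered_implicit_family`, landed/landing p98650) run on the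
space–time lattice of `TimePeriodicNSLattice*` gives a continuous correction `σ(c', x)` of the force along `d` with a free
FOLD coordinate `x` (the phase coordinate pinned by the Poincaré-section functional `w ↦ ∫⟪w(0), ∂ₜu(0)⟫`), corrected
forces carrying periodic orbits uniformly `H¹`-close to `u`; isolation of `u` in its section makes `x ↦ σ(c, x)`
non-constant, and the band engine (the other lead's `stub_familyBand`) concludes.  Everything but `stub_saddleNodeFamily`
(to be registered once Henry's assembly `PeriodicNSOrbitPersists_holds` lands — it shares 80 % of that proof) is proved
below. -/

/-- **Bordered-family periodic persistence** (interface; twin of `familySteady`).  At ONE viscosity `ν ∈ (0,a)` there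
are a direction `d ∈ P_S` and a real correction `σ(c', x)` of the force along `d`, continuous near `(c, 0)`, with
`σ(c, 0) = 0`, such that every corrected force `f_{c' − σ(c',x) d}` carries a time-periodic classical solution with budgets
`≤ E`, `≥ ε`, and `x ↦ σ(c, x)` is NOT identically zero on any neighbourhood of `0`. [folklore] -/
def familyPeriodic (S : Finset (Fin 3 → ℤ)) (a E ε : ℝ) : Set (Coeff S) :=
  {c | ∃ ν : ℝ, 0 < ν ∧ ν < a ∧ ∃ (d : Coeff S) (σ : Coeff S × ℝ → ℝ) (r₀ : ℝ), σ (c, 0) = 0 ∧ 0 < r₀ ∧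
    ContinuousOn σ (Metric.ball (c, (0 : ℝ)) r₀) ∧
    (∀ q ∈ Metric.ball (c, (0 : ℝ)) r₀, ∃ (τ' : ℝ) (u' : ℝ → UnitAddTorus (Fin 3) → EuclideanSpace ℝ (Fin 3))
        (p' : ℝ → UnitAddTorus (Fin 3) → ℝ), 0 < τ' ∧
      IsClassicalNSSolutionOn Set.univ ν (fun _ => force S (q.1 - σ q • d)) u' p' ∧ Function.Periodic u' τ' ∧
        meanEnergy u' ≤ E ∧ ε ≤ meanDissipation ν u') ∧
    ∀ η : ℝ, 0 < η → ∃ x : ℝ, |x| < η ∧ σ (c, x) ≠ 0}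

/-- **Isolated saddle-node periodic witnesses with a visible force direction** (`simplePeriodic`).  `c` carries, at some
`ν ∈ (0,a)`, a genuinely time-dependent `τ`-periodic classical solution `u` with STRICT budgets such that: (i) the
`τ`-periodic solutions of the linearised problem are the complex multiples of `∂ₜu` (geometric simplicity of the multiplier
`1`); (ii) `∂ₜu` HAS a `τ`-periodic Jordan partner (algebraic multiplicity two: saddle-node of cycles — the nondegenerate
case (no partner) is Henry's theorem, class `persistPeriodic`); (iii) some `d ∈ P_S` is first-order visible: the
linearised periodic problem forced by `f_d` has no solution; (iv) `u` is ISOLATED in its Poincaré section: every periodic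
classical solution of the same force with nearby period, uniformly `H¹`-close to `u` after the linear time rescaling and
with `∫⟪u'(0) − u(0), ∂ₜu(0)⟫ = 0`, is `u`. [folklore] -/
def simplePeriodic (S : Finset (Fin 3 → ℤ)) (a E ε : ℝ) : Set (Coeff S) :=
  {c | ∃ ν : ℝ, 0 < ν ∧ ν < a ∧ ∃ (τ : ℝ) (u : ℝ → UnitAddTorus (Fin 3) → EuclideanSpace ℝ (Fin 3))
      (p : ℝ → UnitAddTorus (Fin 3) → ℝ), 0 < τ ∧
    IsClassicalNSSolutionOn Set.univ ν (fun _ => force S c) u p ∧ Function.Periodic u τ ∧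
      meanEnergy u < E ∧ ε < meanDissipation ν u ∧
      (∃ t x, Torus.timeDerivWithin Set.univ u t x ≠ 0) ∧
      (∀ w ∈ linPeriodicSol ν u τ 0, ∃ z : ℂ, w = z • velocityDot u) ∧
      (linPeriodicSol ν u τ (velocityDot u)).Nonempty ∧
      (∃ ρ : ℝ, 0 < ρ ∧ ∀ (τ' : ℝ) (u' : ℝ → UnitAddTorus (Fin 3) → EuclideanSpace ℝ (Fin 3))
          (p' : ℝ → UnitAddTorus (Fin 3) → ℝ), 0 < τ' → |τ' - τ| < ρ →
        IsClassicalNSSolutionOn Set.univ ν (fun _ => force S c) u' p' → Function.Periodic u' τ' →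
        (∀ t, (∫ x, ‖u' t x - u (τ / τ' * t) x‖ ^ 2) + gradNormSq (fun x => u' t x - u (τ / τ' * t) x) < ρ) →
        (∫ x, inner ℝ (u' 0 x - u 0 x) (Torus.timeDerivWithin Set.univ u 0 x)) = 0 → u' = u) ∧
      ∃ d : Coeff S, linPeriodicSol ν u τ (fun _ => cplx (force S d)) = ∅}

/-- **stub_saddleNodeFamily** (space–time lattice; Pi-form; to be REGISTERED in cycle 2, after `PeriodicNSOrbitPersists_holds`).
The doubly bordered implicit function theorem at a saddle-node orbit with a visible force direction, classical form: a
continuous correction `σ(c', x)` along `d`, pinned to the Poincaré section of `u`, whose corrected forces carry periodic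
classical solutions uniformly `H¹`-close to `u` (after the linear time rescaling), off `u` itself when `x ≠ 0`. [folklore] -/
theorem stub_saddleNodeFamily :
    ∀ (S : Finset (Fin 3 → ℤ)) (c d : Coeff S) (ν τ : ℝ) (u : ℝ → UnitAddTorus (Fin 3) → EuclideanSpace ℝ (Fin 3))
      (p : ℝ → UnitAddTorus (Fin 3) → ℝ),
      0 < ν → 0 < τ → IsClassicalNSSolutionOn Set.univ ν (fun _ => force S c) u p → Function.Periodic u τ →
      (∃ t x, Torus.timeDerivWithin Set.univ u t x ≠ 0) →
      (∀ w ∈ linPeriodicSol ν u τ 0, ∃ z : ℂ, w = z • velocityDot u) →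
      (linPeriodicSol ν u τ (velocityDot u)).Nonempty →
      linPeriodicSol ν u τ (fun _ => cplx (force S d)) = ∅ →
      ∃ σ : Coeff S × ℝ → ℝ, σ (c, 0) = 0 ∧ ∀ δ : ℝ, 0 < δ → ∃ r : ℝ, 0 < r ∧
        ContinuousOn σ (Metric.ball (c, (0 : ℝ)) r) ∧
        ∀ q ∈ Metric.ball (c, (0 : ℝ)) r, ∃ (τ' : ℝ) (u' : ℝ → UnitAddTorus (Fin 3) → EuclideanSpace ℝ (Fin 3))
            (p' : ℝ → UnitAddTorus (Fin 3) → ℝ), 0 < τ' ∧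
          IsClassicalNSSolutionOn Set.univ ν (fun _ => force S (q.1 - σ q • d)) u' p' ∧ Function.Periodic u' τ' ∧
          |τ' - τ| < δ ∧
          (∀ t, (∫ x, ‖u' t x - u (τ / τ' * t) x‖ ^ 2) + gradNormSq (fun x => u' t x - u (τ / τ' * t) x) ≤ δ) ∧
          (∫ x, inner ℝ (u' 0 x - u 0 x) (Torus.timeDerivWithin Set.univ u 0 x)) = 0 ∧ (q.2 ≠ 0 → u' ≠ u) := by
  sorry

/-- Local copy of the other lead's registered band engine `stub_familyBand` (pure topology; being landed by that lead —
this file will import it instead once it is in the tree). [folklore] -/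
theorem stub_familyBand :
    ∀ (S : Finset (Fin 3 → ℤ)) (A : Set (Coeff S)) (c d : Coeff S) (σ : Coeff S × ℝ → ℝ) (r : ℝ),
      0 < r → σ (c, 0) = 0 → ContinuousOn σ (Metric.ball (c, (0 : ℝ)) r) →
      (∀ q ∈ Metric.ball (c, (0 : ℝ)) r, q.1 - σ q • d ∈ A) →
      (∀ η : ℝ, 0 < η → ∃ x : ℝ, |x| < η ∧ σ (c, x) ≠ 0) →
      c ∈ closure (interior A) := by
  sorry

/-- A point `(c, x)` with `|x| < r` lies in the ball of radius `r` around `(c, 0)` (sup metric). [folklore] -/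
theorem mk_mem_ball' {S : Finset (Fin 3 → ℤ)} (c : Coeff S) {x r : ℝ} (hx : |x| < r) :
    (c, x) ∈ Metric.ball (c, (0 : ℝ)) r := by
  rw [Metric.mem_ball, Prod.dist_eq, dist_self, Real.dist_eq, sub_zero]
  exact max_lt (lt_of_le_of_lt (abs_nonneg x) hx) hx

/-- **`simplePeriodic ⊆ familyPeriodic`** (from `stub_saddleNodeFamily`): the strict budgets leave a Peter–Paul slack
absorbing a uniform `H¹`-perturbation (window lemmas of `…StubPeriodicWindow.lean`), and ISOLATION in the section forces
`σ(c, x) ≠ 0` for small `x ≠ 0` (else the corrected force is `f_c` itself and carries, in the section, a periodic solution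
`≠ u` within the isolation radius). [folklore] -/
theorem simplePeriodic_subset_familyPeriodic (S : Finset (Fin 3 → ℤ)) (a E ε : ℝ) :
    simplePeriodic S a E ε ⊆ familyPeriodic S a E ε := by
  intro c hc
  obtain ⟨ν, hν, hνa, τ, u, p, hτ, hsol, hper, hE, hε, hmov, hker, hjordan, ⟨ρ, hρ, hiso⟩, d, hvis⟩ := hc
  obtain ⟨σ, hσ0, hwin⟩ := stub_saddleNodeFamily S c d ν τ u p hν hτ hsol hper hmov hker hjordan hvis
  have hu := hsol.smooth_velocity
  obtain ⟨η, hη, hηE, hηD⟩ := PeriodicWindow.exists_eta hE hε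
  obtain ⟨δ, hδ, hδE, hδD⟩ := PeriodicWindow.exists_delta (sE := E - (1 + η) * meanEnergy u)
    (sD := meanDissipation ν u - (1 + η) * ε) (by linarith) (by linarith) hν hη
  -- the family for `δ₁ = min δ ρ / 2` (budgets need `≤ δ`, isolation needs `< ρ`)
  obtain ⟨r, hr, hcont, hball⟩ := hwin (min δ (ρ / 2)) (lt_min hδ (half_pos hρ))
  refine ⟨ν, hν, hνa, d, σ, r, hσ0, hr, hcont, fun q hq => ?_, fun θ hθ => ?_⟩
  · obtain ⟨τ', u', p', hτ', hsol', hper', -, hcl, -, -⟩ := hball q hq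
    have hu' := hsol'.smooth_velocity
    have hclδ : ∀ t, (∫ x, ‖u' t x - u (τ / τ' * t) x‖ ^ 2) + gradNormSq (fun x => u' t x - u (τ / τ' * t) x) ≤ δ :=
      fun t => (hcl t).trans (min_le_left _ _)
    refine ⟨τ', u', p', hτ', hsol', hper', ?_, ?_⟩
    · have hcl2 : ∀ t, ∫ x, ‖u' t x - u (τ / τ' * t) x‖ ^ 2 ≤ δ := fun t =>
        le_trans (le_add_of_nonneg_right (gradNormSq_nonneg _)) (hclδ t)
      have h := PeriodicWindow.meanEnergy_le_of_close hu hper hτ hu' hper' hτ' hη hcl2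
      linarith
    · have hcl1 : ∀ t, gradNormSq (fun x => u' t x - u (τ / τ' * t) x) ≤ δ := fun t =>
        le_trans (le_add_of_nonneg_left (integral_nonneg fun x => sq_nonneg _)) (hclδ t)
      have h := PeriodicWindow.meanDissipation_ge_of_close hu hper hτ hu' hper' hτ' hν.le hη hcl1
      have hη1 : 0 < 1 + η := by linarith
      have h2 : ε ≤ (1 + η)⁻¹ * (meanDissipation ν u - ν * ((1 + η⁻¹) * δ)) := by
        rw [le_inv_mul_iff₀ hη1]
        linarith
      exact h2.trans h
  · -- non-constancy of `x ↦ σ(c, x)` from isolation in the section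
    set x : ℝ := min (θ / 2) (r / 2) with hx
    have hx0 : 0 < x := lt_min (by linarith) (by linarith)
    have hxθ : |x| < θ := by
      rw [abs_of_pos hx0]; exact (min_le_left _ _).trans_lt (by linarith)
    have hxr : |x| < r := by
      rw [abs_of_pos hx0]; exact (min_le_right _ _).trans_lt (by linarith)
    refine ⟨x, hxθ, fun hσx => ?_⟩
    obtain ⟨τ', u', p', hτ', hsol', hper', hττ', hcl, hsec, hne⟩ := hball (c, x) (mk_mem_ball' c hxr)
    have hsol'' : IsClassicalNSSolutionOn Set.univ ν (fun _ => force S c) u' p' := by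
      have e : ((c, x) : Coeff S × ℝ).1 - σ (c, x) • d = c := by rw [hσx, zero_smul, sub_zero]
      rwa [e] at hsol'
    have hρ2 : min δ (ρ / 2) < ρ := (min_le_right _ _).trans_lt (by linarith)
    have hclρ : ∀ t, (∫ y, ‖u' t y - u (τ / τ' * t) y‖ ^ 2) + gradNormSq (fun y => u' t y - u (τ / τ' * t) y) < ρ :=
      fun t => (hcl t).trans_lt hρ2
    exact hne hx0.ne' (hiso τ' u' p' hτ' (hττ'.trans hρ2) hsol'' hper' hclρ hsec)

/-- **`familyPeriodic ⊆ closure (interior LOUD)`** (from the band engine): the corrected forces carry periodic classical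
solutions with budgets, i.e. loud witnesses, and `stub_familyBand` concludes. [folklore] -/
theorem familyPeriodic_subset_closure_interior_loud (S : Finset (Fin 3 → ℤ)) (a E ε : ℝ) :
    familyPeriodic S a E ε ⊆ closure (interior (loud S a E ε)) := by
  intro c hc
  obtain ⟨ν, hν, hνa, d, σ, r₀, hσ0, hr₀, hcont, hgood, hnc⟩ := hc
  refine stub_familyBand S (loud S a E ε) c d σ r₀ hr₀ hσ0 hcont (fun q hq => ?_) hnc
  obtain ⟨τ', u', p', hτ', hsol', hper', hE', hε'⟩ := hgood q hq
  exact ⟨ν, hν, hνa, τ', u', p', hτ', hsol', hper', hE', hε'⟩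

/-- **The new periodic class is tame**: `simplePeriodic ⊆ closure (interior LOUD)` at the same strict budgets. [folklore] -/
theorem simplePeriodic_subset_closure_interior_loud (S : Finset (Fin 3 → ℤ)) (a E ε : ℝ) :
    simplePeriodic S a E ε ⊆ closure (interior (loud S a E ε)) :=
  (simplePeriodic_subset_familyPeriodic S a E ε).trans (familyPeriodic_subset_closure_interior_loud S a E ε)

/-- **Companion glue, curried (registered sub-goal `line_glue_c1`)**: for every tame union `T ⊇ tameLeaf` upgrading to
`closure (interior LOUD)`, the residual restricted to `loudTurb` proves the crux (`RobustLoudUpgrade_of_turbulentResidual`).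
[folklore] -/
theorem line_glue_c1 : ∀ (T : ∀ S : Finset (Fin 3 → ℤ), ℝ → ℝ → ℝ → Set (Coeff S)), (∀ (S : Finset (Fin 3 → ℤ)) (a E ε : ℝ), tameLeaf S a E ε ⊆ T S a E ε) → (∀ (S : Finset (Fin 3 → ℤ)) (a E ε : ℝ), T S a E ε ⊆ closure (interior (loud S a E ε))) → (∀ S : Finset (Fin 3 → ℤ), unitStock ⊆ S → ∀ (a E ε : ℝ), 0 < a → 0 < ε → loudTurb S a E ε ⊆ closure (T S a (2 * E) (ε / 2))) → RobustLoudUpgrade :=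
  fun T hTame hT hRes => RobustLoudUpgrade_of_turbulentResidual T hTame hT hRes

end Summit.AnomalousDissipation.AnomalousDissipation.Cruxes.RobustLoudUpgrade.LaminarCorner

end
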